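import Literature.Probability.Process.ItoIntegralStopping
import Literature.Probability.Process.ItoIntegralNegation
import HarnessLib

/-!
# Linearity of the characterised Itô integral: `∫ (H ± H') dB = ∫ H dB ± ∫ H' dB`

Topic `Probability/Process`; theorems only, generic in the filtered probability space
`(Ω, 𝓕, μ)` and in the integrator `B`. For the characterising predicate
`Literature.Probability.Process.IsItoIntegral` of `ItoCalculus.lean` (`J` vanishes at `0`, is
a.s. continuous and a local martingale, `H` admits approximating bounded simple processes, and
along *every* such sequence the elementary integrals converge to `J` u.c.p.) we record the
linearity statements of Revuz–Yor, Ch. IV, eq. (2.4) and Prop. (2.10)(i) ("the map `K ↦ K·M`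
is linear"):

* `IsItoIntegral.sub`: `J = ∫ H dB`, `J' = ∫ H' dB` ⇒ `J - J' = ∫ (H - H') dB`;
* `IsItoIntegral.add`: `J + J' = ∫ (H + H') dB`.

The u.c.p. core is `IsItoIntegral.tendstoUCP_integral_sub` (`ItoIntegralStopping`): along every
approximating sequence `Kₙ` of `H - H'` the elementary integrals `Kₙ·B` converge u.c.p. to
`J - J'`; approximating sequences subtract (`SimpleProcess.IsApproxSeq.sub`, integrands with Borel
paths). The one conjunct of `IsItoIntegral` that is *not* derived here is the local-martingale
property of `J ∓ J'`: for the raw (uncompleted, not right-continuous) filtrations used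
throughout `Literature`, closure of `Literature.Probability.RandomPlanarGeometry.IsLocalMartingale`
under sums needs optional stopping in continuous time, which the tree does not have; it is
therefore taken as the hypothesis `hLM` (automatic when `J`, `J'` are martingales — the case of
square-integrable integrands, `exists_isItoIntegral_of_sq_integrable` — via
`MeasureTheory.Martingale.sub` / `.add` and `Martingale.isLocalMartingale`; see
`IsItoIntegral.sub_of_martingale`, `IsItoIntegral.add_of_martingale`).

## References

* D. Revuz, M. Yor, *Continuous Martingales and Brownian Motion* (3rd ed., 1999), Ch. IV,
  Def. (2.3), eq. (2.4), Thm (2.2), Prop. (2.10)(i), Prop. (2.13).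
-/

noncomputable section

open MeasureTheory Filter
open scoped NNReal

namespace Literature.Probability.Process

variable {Ω : Type*} {m : MeasurableSpace Ω} {𝓕 : Filtration ℝ≥0 m} {μ : Measure Ω}
  {B H H' J J' : ℝ≥0 → Ω → ℝ}

/-- **`∫ (H - H') dB = ∫ H dB - ∫ H' dB`** in the Itô characterisation: if `J = ∫ H dB` and
`J' = ∫ H' dB` (integrands with Borel paths) and `J - J'` is a local martingale, then `J - J'` is
the Itô integral of `H - H'`. Approximating sequences subtract (`IsApproxSeq.sub`), and along every
approximating sequence of `H - H'` the elementary integrals converge u.c.p. to `J - J'`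
(`IsItoIntegral.tendstoUCP_integral_sub`).
Revuz–Yor (1999), Ch. IV, eq. (2.4) and Prop. (2.10)(i). [cite: RevuzYor1999, Ch. IV Prop. (2.10)(i)] -/
theorem IsItoIntegral.sub (hJ : IsItoIntegral H B J 𝓕 μ) (hJ' : IsItoIntegral H' B J' 𝓕 μ)
    (hH : ∀ ω, Measurable fun s : ℝ ↦ H s.toNNReal ω)
    (hH' : ∀ ω, Measurable fun s : ℝ ↦ H' s.toNNReal ω)
    (hLM : RandomPlanarGeometry.IsLocalMartingale (fun t ω ↦ J t ω - J' t ω) 𝓕 μ) :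
    IsItoIntegral (fun t ω ↦ H t ω - H' t ω) B (fun t ω ↦ J t ω - J' t ω) 𝓕 μ := by
  obtain ⟨Hn, hHn⟩ := hJ.2.2.2.1
  obtain ⟨Kn, hKn⟩ := hJ'.2.2.2.1
  refine ⟨fun ω ↦ by simp only [hJ.apply_zero ω, hJ'.apply_zero ω, sub_zero], ?_, hLM,
    ⟨fun n ↦ (Hn n).sub (Kn n), hHn.sub hKn hH hH'⟩,
    fun Gn hGn ↦ hJ.tendstoUCP_integral_sub hJ' hH hH' hGn⟩
  filter_upwards [hJ.continuous, hJ'.continuous] with ω h1 h2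
  exact h1.sub h2

/-- **`∫ (H + H') dB = ∫ H dB + ∫ H' dB`** in the Itô characterisation (integrands with Borel
paths; the local-martingale property of `J + J'` as hypothesis): from `IsItoIntegral.sub` and
`IsItoIntegral.neg` (`H + H' = H - (-H')`).
Revuz–Yor (1999), Ch. IV, eq. (2.4) and Prop. (2.10)(i). [cite: RevuzYor1999, Ch. IV Prop. (2.10)(i)] -/
theorem IsItoIntegral.add (hJ : IsItoIntegral H B J 𝓕 μ) (hJ' : IsItoIntegral H' B J' 𝓕 μ)
    (hH : ∀ ω, Measurable fun s : ℝ ↦ H s.toNNReal ω)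
    (hH' : ∀ ω, Measurable fun s : ℝ ↦ H' s.toNNReal ω)
    (hLM : RandomPlanarGeometry.IsLocalMartingale (fun t ω ↦ J t ω + J' t ω) 𝓕 μ) :
    IsItoIntegral (fun t ω ↦ H t ω + H' t ω) B (fun t ω ↦ J t ω + J' t ω) 𝓕 μ := by
  have h := hJ.sub hJ'.neg hH (fun ω ↦ (hH' ω).neg) (by simpa only [sub_neg_eq_add] using hLM)
  simpa only [sub_neg_eq_add] using h

/-- `IsItoIntegral.sub` for martingale integrals: if `J`, `J'` are martingales (e.g. the
square-integrable integrals of `exists_isItoIntegral_of_sq_integrable`), the local-martingale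
hypothesis is automatic. [cite: RevuzYor1999, Ch. IV Prop. (2.10)(i)] -/
theorem IsItoIntegral.sub_of_martingale (hJ : IsItoIntegral H B J 𝓕 μ)
    (hJ' : IsItoIntegral H' B J' 𝓕 μ) (hH : ∀ ω, Measurable fun s : ℝ ↦ H s.toNNReal ω)
    (hH' : ∀ ω, Measurable fun s : ℝ ↦ H' s.toNNReal ω) (hM : Martingale J 𝓕 μ)
    (hM' : Martingale J' 𝓕 μ) :
    IsItoIntegral (fun t ω ↦ H t ω - H' t ω) B (fun t ω ↦ J t ω - J' t ω) 𝓕 μ :=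
  hJ.sub hJ' hH hH' (hM.sub hM').isLocalMartingale

/-- `IsItoIntegral.add` for martingale integrals. [cite: RevuzYor1999, Ch. IV Prop. (2.10)(i)] -/
theorem IsItoIntegral.add_of_martingale (hJ : IsItoIntegral H B J 𝓕 μ)
    (hJ' : IsItoIntegral H' B J' 𝓕 μ) (hH : ∀ ω, Measurable fun s : ℝ ↦ H s.toNNReal ω)
    (hH' : ∀ ω, Measurable fun s : ℝ ↦ H' s.toNNReal ω) (hM : Martingale J 𝓕 μ)
    (hM' : Martingale J' 𝓕 μ) :
    IsItoIntegral (fun t ω ↦ H t ω + H' t ω) B (fun t ω ↦ J t ω + J' t ω) 𝓕 μ :=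
  hJ.add hJ' hH hH' (hM.add hM').isLocalMartingale

end Literature.Probability.Process
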